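import Summits.PneNP.PneNP.Theorems.ExpanderLinearGeneratorsPolyCalcArith
import HarnessLib

/-!
# Clauses as polynomials over a field of characteristic `≠ 2`: Fourier expansion and the
clause identity

Support file for item `stmt-PneNP-11444` (`LinearGeneratorModPFregeHard`), part of the
POLYNOMIAL CALCULUS RUNG (`…PolyCalcDegree.lean`); continuation of `…PolyCalcArith.lean`
(which it imports: the group algebra `K[ParityVec]`, the moment functional and the
arithmetisation `phiK`).  Contents (transcribed from the real-valued
`Literature/…/XorPseudoexpectation.lean` to an arbitrary field `K` with `2 ≠ 0`):

* the translation (6.0.1) of clauses into polynomials over `K`: `litFalsePolyK`, `unsatPolyK`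
  (`= ∏_{l ∈ C} litFalsePolyK l`, the standard PC encoding of a clause; over `ℝ` this is
  `unsatPoly` of `SumOfSquares.lean`), its degree `totalDegree_unsatPolyK`, its semantics
  `eval_unsatPolyK`, and its Fourier expansion `phiK_unsatPolyK` with `K`-valued signs
  `litSignK / posSignK / clauseSignK`;
* `cnfPolys K φ` — the PC axiom set `{unsatPolyK C : C ∈ φ}` of a CNF;
* the pairing `sum_posSignK_pseudoMomentK_eq_zero` and the CLAUSE IDENTITY
  `momentFunctionalK_phiK_unsatPolyK_mul`: `L(phiK (unsatPolyK C) · z) = 0` for the `K`-valued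
  pseudo-moments (`…PolyCalcSigns.lean`) of an expanding family on which `C` sits.

Sources: D. Grigoriev, TCS 259 (2001) §2; G. Schoenebeck, FOCS 2008 §5; S. Buss, D. Grigoriev,
R. Impagliazzo, T. Pitassi, JCSS 62 (2001) §3–4; J. Krajíček, *Proof Complexity* (2019) (6.0.1).
Adapted from `Literature/Computability/MetaComplexity/XorPseudoexpectation.lean`.
-/

noncomputable section

set_option linter.dupNamespace false -- `Summit.PneNP.PneNP.…`: summit = sub-problem (D-0017)

namespace Summit.PneNP.PneNP.Theorems.PolyCalc

open Finset MvPolynomial Literature.Computability.Complexity Literature.Computability.MetaComplexity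
open scoped symmDiff

section Clauses

variable {K : Type*} [Field K]

/-! ### Clauses as polynomials over `K`, and their Fourier expansion -/

/-- The `0/1`-arithmetisation over `K` of a literal's FALSITY: `(v, true) ↦ 1 - x_v`,
`(v, false) ↦ x_v` (the tree's literal `(v, b)` is true iff `x_v = b`). [Krajíček 2019, (6.0.1);
Kothari–Mori–O'Donnell–Witmer 2017, §2.3] [folklore] -/
def litFalsePolyK (l : Literal ℕ) : MvPolynomial ℕ K :=
  if l.2 then 1 - X l.1 else X l.1

variable (K) in
/-- The translation of a clause into a polynomial over `K` (Krajíček's (6.0.1), the standard PC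
encoding): `∏_{l ∈ C} litFalsePolyK l`, which vanishes at a Boolean point iff the clause is
satisfied there; over `ℝ` it is `unsatPoly C` of `SumOfSquares.lean`.
[Krajíček 2019, §6 (6.0.1); Buss–Grigoriev–Impagliazzo–Pitassi 2001, §2] [folklore] -/
def unsatPolyK (C : Clause ℕ) : MvPolynomial ℕ K :=
  (C.map litFalsePolyK).prod
-- TODO(general form): `unsatPoly` (ℝ) of `Literature/…/SumOfSquares.lean` is the case `K = ℝ`;
-- a librarian may merge both as the (6.0.1) translation over any commutative ring.

/-- The `±1` sign of a literal in `K`: `+1` for a positive literal, `-1` for a negative one.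
[Schoenebeck 2008, §5] [folklore] -/
def litSignK (l : Literal ℕ) : K :=
  if l.2 then 1 else -1

/-- `litSignK l = ±1`. [folklore] -/
theorem litSignK_mul_self (l : Literal ℕ) : litSignK (K := K) l * litSignK l = 1 := by
  unfold litSignK; split <;> simp

/-- `(1 - y_v)/2` in the monomial basis. [folklore] -/
theorem phiXK_eq (v : ℕ) : phiXK (K := K) v =
    ymon 0 (1 / 2 : K) - ymon (Finsupp.single v 1) (1 / 2 : K) := by
  rw [phiXK, smul_sub, AddMonoidAlgebra.one_def, AddMonoidAlgebra.smul_single',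
    AddMonoidAlgebra.smul_single', mul_one]

/-- `1 - 1/2 = 1/2` when `2 ≠ 0`. [folklore] -/
theorem one_sub_half (h2 : (2 : K) ≠ 0) : (1 : K) - 1 / 2 = 1 / 2 := by
  rw [sub_eq_iff_eq_add, ← add_div, show (1 : K) + 1 = 2 by norm_num, div_self h2]

/-- The falsity polynomial of a literal becomes `(1 + s_l y_v)/2` (`2 ≠ 0`). [Schoenebeck 2008,
§5] [folklore] -/
theorem phiK_litFalsePolyK (h2 : (2 : K) ≠ 0) (l : Literal ℕ) : phiK K (litFalsePolyK l) =
    ymon 0 (1 / 2 : K) + ymon (Finsupp.single l.1 1) (litSignK l / 2) := by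
  rcases l with ⟨v, _ | _⟩
  · simp only [litFalsePolyK, litSignK, Bool.false_eq_true, if_false, phiK_X, phiXK_eq]
    rw [sub_eq_add_neg, ← AddMonoidAlgebra.single_neg, neg_div]
  · simp only [litFalsePolyK, litSignK, if_true, map_sub, map_one, phiK_X, phiXK_eq]
    have h : (ymon 0 (1 : K) : ParityAlgK K) - ymon 0 (1 / 2 : K) = ymon 0 (1 / 2 : K) := by
      rw [← AddMonoidAlgebra.single_sub, one_sub_half h2]
    rw [AddMonoidAlgebra.one_def,
      show ∀ S A B : ParityAlgK K, S - (A - B) = (S - A) + B from fun S A B => by abel, h]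

/-- The sign of a set of literal positions, in `K`: `∏_{j ∈ J} s_{C_j}`. [Schoenebeck 2008, §5]
[folklore] -/
def posSignK (C : Clause ℕ) (J : Finset (Fin C.length)) : K :=
  ∏ j ∈ J, litSignK C[j]

variable (K) in
/-- The right-hand side in `K` of the parity constraint implied by a clause:
`y_{scope} = -∏_j s_j`. [Schoenebeck 2008, §5] [folklore] -/
def clauseSignK (C : Clause ℕ) : K :=
  -posSignK C Finset.univ

/-- `posSignK C J = ±1`. [folklore] -/
theorem posSignK_mul_self (C : Clause ℕ) (J : Finset (Fin C.length)) :
    posSignK (K := K) C J * posSignK C J = 1 := by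
  rw [posSignK, ← Finset.prod_mul_distrib]
  exact Finset.prod_eq_one fun j _ => litSignK_mul_self _

/-- `clauseSignK C = ±1`. [folklore] -/
theorem clauseSignK_mul_self (C : Clause ℕ) : clauseSignK K C * clauseSignK K C = 1 := by
  rw [clauseSignK, neg_mul_neg, posSignK_mul_self]

/-- Complementary positions: `σ_{Jᶜ} = σ_{all} σ_J`. [folklore] -/
theorem posSignK_compl (C : Clause ℕ) (J : Finset (Fin C.length)) :
    posSignK (K := K) C (Finset.univ \ J) = posSignK C Finset.univ * posSignK C J := by
  have h := Finset.prod_sdiff (f := fun j => litSignK (K := K) C[j]) (Finset.subset_univ J)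
  have h2 := posSignK_mul_self (K := K) C J
  unfold posSignK at *
  rw [← h]
  linear_combination -(∏ x ∈ univ \ J, litSignK (K := K) C[x]) * h2

/-- **Fourier expansion of a clause** over `K` (`2 ≠ 0`):
`phiK (unsatPolyK C) = 2^{-k} Σ_{J ⊆ positions} σ_J y_{litVec J}`.
[Buss–Grigoriev–Impagliazzo–Pitassi 2001, §3; Schoenebeck 2008, §5] [folklore] -/
theorem phiK_unsatPolyK (h2 : (2 : K) ≠ 0) (C : Clause ℕ) :
    phiK K (unsatPolyK K C) = ∑ J ∈ (Finset.univ : Finset (Fin C.length)).powerset,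
      ymon (litVec C J) ((1 / 2 : K) ^ C.length * posSignK C J) := by
  have h1 : unsatPolyK K C = ∏ j : Fin C.length, litFalsePolyK C[j] := by
    rw [unsatPolyK, ← List.prod_ofFn]
    congr 1
    exact (List.ofFn_getElem_eq_map C litFalsePolyK).symm
  rw [h1, map_prod]
  simp_rw [phiK_litFalsePolyK h2, add_comm (ymon (0 : ParityVec) _)]
  rw [Finset.prod_add]
  refine Finset.sum_congr rfl fun J hJ => ?_
  rw [AddMonoidAlgebra.prod_single, AddMonoidAlgebra.prod_single, Finset.sum_const_zero,
    Finset.prod_const, AddMonoidAlgebra.single_mul_single, add_zero]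
  show ymon (litVec C J) _ = ymon (litVec C J) _
  congr 1
  have hJ : J.card ≤ C.length := by simpa using Finset.card_le_univ J
  rw [Finset.prod_div_distrib, Finset.prod_const, Finset.card_sdiff_of_subset (Finset.subset_univ J),
    Finset.card_univ, Fintype.card_fin, posSignK, div_eq_mul_inv, ← inv_pow, ← one_div, mul_assoc,
    ← pow_add, Nat.add_sub_cancel' hJ, mul_comm]

/-- The falsity polynomial of a literal has degree one. [folklore] -/
theorem totalDegree_litFalsePolyK (l : Literal ℕ) : (litFalsePolyK (K := K) l).totalDegree = 1 := by
  unfold litFalsePolyK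
  split
  · rw [show (1 : MvPolynomial ℕ K) - X l.1 = -X l.1 + 1 by ring,
      totalDegree_add_eq_left_of_totalDegree_lt, totalDegree_neg, totalDegree_X]
    rw [totalDegree_neg, totalDegree_X, totalDegree_one]
    exact zero_lt_one
  · exact totalDegree_X _

/-- Hence it is nonzero. [folklore] -/
theorem litFalsePolyK_ne_zero (l : Literal ℕ) : litFalsePolyK (K := K) l ≠ 0 := by
  intro h
  have := totalDegree_litFalsePolyK (K := K) l
  rw [h, totalDegree_zero] at this
  exact zero_ne_one this

/-- `unsatPolyK C ≠ 0`. [folklore] -/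
theorem unsatPolyK_ne_zero (C : Clause ℕ) : unsatPolyK K C ≠ 0 := by
  induction C with
  | nil => simp [unsatPolyK]
  | cons l C ih =>
    rw [unsatPolyK, List.map_cons, List.prod_cons]
    exact mul_ne_zero (litFalsePolyK_ne_zero l) ih

/-- **Degree of a clause polynomial**: `deg (unsatPolyK C) = |C|`. [Krajíček 2019, §6]
[folklore] -/
theorem totalDegree_unsatPolyK (C : Clause ℕ) : (unsatPolyK K C).totalDegree = C.length := by
  induction C with
  | nil => simp [unsatPolyK]
  | cons l C ih =>
    have h : unsatPolyK K (l :: C) = litFalsePolyK l * unsatPolyK K C := by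
      rw [unsatPolyK, List.map_cons, List.prod_cons]; rfl
    rw [h, totalDegree_mul_of_isDomain (litFalsePolyK_ne_zero l) (unsatPolyK_ne_zero C),
      totalDegree_litFalsePolyK, ih, List.length_cons, add_comm]

/-- **Semantics of the translation**: at a Boolean point, `unsatPolyK C` evaluates to `0` if the
clause is satisfied and to `1` otherwise. [Krajíček 2019, §6 (6.0.1)] [folklore] -/
theorem eval_unsatPolyK (σ : ℕ → Bool) (C : Clause ℕ) :
    MvPolynomial.eval (fun v => if σ v then (1 : K) else 0) (unsatPolyK K C) =
      if C.eval σ then 0 else 1 := by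
  induction C with
  | nil => simp [unsatPolyK, Clause.eval]
  | cons l C ih =>
    have h : unsatPolyK K (l :: C) = litFalsePolyK l * unsatPolyK K C := by
      rw [unsatPolyK, List.map_cons, List.prod_cons]; rfl
    have hl : MvPolynomial.eval (fun v => if σ v then (1 : K) else 0) (litFalsePolyK l) =
        if l.eval σ then 0 else 1 := by
      rcases l with ⟨v, b⟩
      cases b <;> cases hσ : σ v <;> simp [litFalsePolyK, Literal.eval, hσ]
    rw [h, map_mul, ih, hl]
    simp only [Clause.eval, List.any_cons]
    by_cases h1 : Literal.eval σ l = true <;> by_cases h2 : C.any (Literal.eval σ) = true <;>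
      simp [h1, h2]

/-! ### The translated axiom set of a CNF -/

variable (K) in
/-- The PC axiom polynomials of a CNF over `K`: the clause polynomials `unsatPolyK C`, `C ∈ φ`
(Krajíček's translation (6.0.1); the Boolean axioms `x² - x` are part of the calculus
`PC.DerivableInDegree`). [Krajíček 2019, §6 (6.0.1)] [folklore] -/
def cnfPolys (φ : CNF ℕ) : Set (MvPolynomial ℕ K) :=
  {p | ∃ C ∈ φ, p = unsatPolyK K C}

/-- Membership in the translated axiom set. [folklore] -/
theorem mem_cnfPolys {φ : CNF ℕ} {p : MvPolynomial ℕ K} :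
    p ∈ cnfPolys K φ ↔ ∃ C ∈ φ, p = unsatPolyK K C := Iff.rfl

end Clauses

/-! ### The clause identities via the complement pairing -/

section Pairing

variable {K : Type*} [Field K] {ι : Type*} [DecidableEq ι] {g : ι → ParityVec} {b : ι → K}
  {r c : ℝ} {d : ℕ}

/-- **The pairing.** For a clause `C` sitting at index `i` of an expanding family (`g i` its
scope vector, `b i` its sign) and `U` with `|U| + |C| ≤ d`:
`Σ_{J ⊆ positions} σ_J Ẽ[y_{litVec J + U}] = 0`, by the fixed-point-free involution
`J ↦ positions ∖ J`. [Grigoriev 2001, §2; Buss–Grigoriev–Impagliazzo–Pitassi 2001, §4]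
[folklore] -/
theorem sum_posSignK_pseudoMomentK_eq_zero (hexp : VecExpands g r c) (hc : 0 < c)
    (hd : (d : ℝ) ≤ c * r / 2) (hr : 2 ≤ r) (hb : ∀ i, b i * b i = 1) (C : Clause ℕ)
    (hC : 0 < C.length) (i : ι) (hgi : g i = clauseVec C) (hbi : b i = clauseSignK K C)
    (U : ParityVec) (hU : U.support.card + C.length ≤ d) :
    ∑ J ∈ (Finset.univ : Finset (Fin C.length)).powerset,
      posSignK C J * pseudoMomentK g b r d (litVec C J + U) = 0 := by
  refine Finset.sum_involution (fun J _ => Finset.univ \ J) ?_ ?_ ?_ ?_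
  · -- cancellation in pairs
    intro J hJ
    have hT : (litVec C J + U).support.card ≤ d := by
      have h1 := card_support_add_le (litVec C J) U
      have h2 := card_support_litVec_le C J
      have h3 : J.card ≤ C.length := by simpa using Finset.card_le_univ J
      omega
    have hT' : (g i + (litVec C J + U)).support.card ≤ d := by
      have h1' := card_support_add_le (litVec C (Finset.univ \ J)) U
      have h2 := card_support_litVec_le C (Finset.univ \ J)
      have h3 : (Finset.univ \ J).card ≤ C.length := by
        simpa using Finset.card_le_univ (Finset.univ \ J)
      rw [hgi, ← add_assoc, ← litVec_compl]
      omega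
    rw [litVec_compl, posSignK_compl, ← hgi, add_assoc]
    have hs := posSignK_mul_self (K := K) C Finset.univ
    by_cases hD : Derivable g r d (litVec C J + U)
    · rw [(pseudoMomentK_index_add hexp hc hd hr hb i hD hT').2, hbi, clauseSignK]
      linear_combination (-(posSignK C J) * pseudoMomentK g b r d (litVec C J + U)) * hs
    · rw [pseudoMomentK_of_not hD,
        pseudoMomentK_of_not (not_derivable_index_add' hexp hc hd hr i hD hT)]
      ring
  · -- no fixed points
    intro J hJ _ hfix
    have hne : (Finset.univ : Finset (Fin C.length)).Nonempty :=
      Finset.univ_nonempty_iff.2 ⟨⟨0, hC⟩⟩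
    have h1 : J ∩ (Finset.univ \ J) = ∅ := Finset.inter_sdiff_self J Finset.univ
    rw [hfix, Finset.inter_self] at h1
    rw [h1, Finset.sdiff_empty] at hfix
    exact hne.ne_empty hfix
  · intro J hJ
    exact Finset.mem_powerset.2 (Finset.subset_univ _)
  · intro J hJ
    exact Finset.sdiff_sdiff_eq_self (Finset.mem_powerset.1 hJ)

/-- **Clause identity for the moment functional**: `L(phiK(unsatPolyK C) · z) = 0` whenever every
monomial `y_U` of `z` has `|U| + |C| ≤ d`. [Grigoriev 2001, §2; Ben-Sasson–Impagliazzo 2010, §4]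
[folklore] -/
theorem momentFunctionalK_phiK_unsatPolyK_mul (h2 : (2 : K) ≠ 0) (hexp : VecExpands g r c)
    (hc : 0 < c) (hd : (d : ℝ) ≤ c * r / 2) (hr : 2 ≤ r) (hb : ∀ i, b i * b i = 1)
    (C : Clause ℕ) (hC : 0 < C.length) (i : ι) (hgi : g i = clauseVec C)
    (hbi : b i = clauseSignK K C) (z : ParityAlgK K)
    (hz : ∀ U ∈ z.coeff.support, U.support.card + C.length ≤ d) :
    momentFunctionalK (pseudoMomentK g b r d) (phiK K (unsatPolyK K C) * z) = 0 := by
  rw [phiK_unsatPolyK h2, Finset.sum_mul, map_sum]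
  simp_rw [momentFunctionalK_single_mul]
  rw [Finset.sum_comm]
  refine Finset.sum_eq_zero fun U hU => ?_
  have h := sum_posSignK_pseudoMomentK_eq_zero hexp hc hd hr hb C hC i hgi hbi U (hz U hU)
  calc ∑ J ∈ (Finset.univ : Finset (Fin C.length)).powerset,
        (1 / 2 : K) ^ C.length * posSignK C J * z.coeff U * pseudoMomentK g b r d (litVec C J + U)
      = (1 / 2 : K) ^ C.length * z.coeff U *
          ∑ J ∈ (Finset.univ : Finset (Fin C.length)).powerset,
            posSignK C J * pseudoMomentK g b r d (litVec C J + U) := by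
        rw [Finset.mul_sum]
        exact Finset.sum_congr rfl fun J _ => by ring
    _ = 0 := by rw [h, mul_zero]

end Pairing

end Summit.PneNP.PneNP.Theorems.PolyCalc
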